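import Literature.Analysis.FluidPDE.SereginSverakBlowup
import Literature.Analysis.FluidPDE.SereginSverakBlowupSelection
import HarnessLib

/-!
# Seregin–Šverák 2009, §4: the blow-up alternative under Type I from its two analytic inputs

G. Seregin, V. Šverák, *On Type I singularities of the local axi-symmetric solutions of the
Navier–Stokes equations*, Comm. PDE 34 (2009) 171–201 = arXiv:0804.1803 (page references are to
the arXiv version). Sibling of `SereginSverakBlowup.lean`, which vendors the blow-up alternative
of §4 under the Type I bound of Thm. 3.1 as the named fact
`SereginSverak2009.BlowupAlternativeTypeI`, together with the two analytic inputs of the printed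
§4 that are not in Mathlib: `SereginSverak2009.InteriorContinuity` (§4 ¶1, the continuous
representative `v`) and `SereginSverak2009.BlowupCompactness` ((p5)–(p12)ff, the passage to the
limit in the rescaled sequence). This file PROVES the reduction announced in that file's module
docstring,

`SereginSverak2009.blowupAlternativeTypeI_of_facts :
  InteriorContinuity → BlowupCompactness → BlowupAlternativeTypeI`,

i.e. steps (ii) (selection of the centres) and (iii) (the axis-centred rescaling) of the printed
proof and all the bookkeeping that feeds step (iv), using the elementary selection and rescaling
lemmas of `SereginSverakBlowupSelection.lean` (`exists_centre`, `stAffine_mem_backCyl_of_mem`,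
`parCyl_subset_preimage_stAffine`, …) and the accepted covariance of distributional solutions
`IsDistributionalNSSolutionOn.stRescale`. The unconditional discharge
`BlowupAlternativeTypeI_holds` is thereby reduced to `InteriorContinuity_holds` and
`BlowupCompactness_holds` (local `L_p` theory of the Stokes system [S8], the [LSU] gradient
estimate, parabolic embeddings and compactness), which are not attempted here; the corollary
`isRegularAtOrigin_of_typeI_of_facts` records Thm. 3.1 conditionally on exactly these catalogued
inputs (plus Lemma 3.5, Prop. 3.7 and KNSS 2009, Thm. 5.3).

## The printed steps (arXiv p. 11) and their rendering in the proof

* "We may also assume that the function `v` is Hölder continuous …": `InteriorContinuity` gives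
  `v` continuous on `Q` with `v = u` a.e.; the a.e. hypotheses (r3) (Type I on `Q`) and the output
  of Prop. 3.7 (`|x'||u| ≤ C₂` a.e. on `Q(1/8)`) become pointwise bounds for `v`
  (`forall_mul_norm_le_of_ae`).
* "let us suppose that our statement is wrong, i.e., `z = 0` is a singular point. Then there are
  sequences `x_k`, `t_k` … `h(t_k) = H(t_k) = M_k = |v(x_k,t_k)| → +∞`": `exists_centre` (the
  weighted-maximum selection of the sibling file, level `N = k + K₀`, `K₀ = 4 max(C₂, 0) + 1`)
  gives centres `z_k = (t_k, x_k) ∈ Q(1/8)`, `|x_{k3}| ≤ 1/10`, sizes `0 < d_k ≤ 1/10` with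
  `k + K₀ ≤ M_k d_k`, `M_k = |v(z_k)|`, and `|v| ≤ 2M_k` on the backward cylinder
  `{t_k - d_k²/4 < t ≤ t_k} × 𝒞(x_k, d_k/2) ⊆ Q(1/8)` (in print the factor is `1`).
* "`u^k(y,s) = λ_k v(λ_k y', x_{3k} + λ_k y₃, t_k + λ_k² s)`, `λ_k = 1/M_k`,
  `p^k = λ_k² q(…)`. These functions satisfy the Navier–Stokes equations in `Q(M_k)`": with
  `λ_k = 1/(2M_k)` (so that `sup |u^k| ≤ 1`, (p5)) the fields `u^k = λ_k u ∘ Φ_k`,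
  `p^k = λ_k² p ∘ Φ_k`, `Φ_k(s, y) = (t_k + λ_k² s, x_{k3} e₃ + λ_k y)`, solve Navier–Stokes in the
  sense of distributions in `Φ_k⁻¹(Q) ⊇ Q(R_k)`, `R_k = d_k M_k - 2M_k|x_k'| ≥ k + K₀ - 2C₂ → ∞`
  (`IsDistributionalNSSolutionOn.stRescale`, `.of_le`, `parCyl_subset_preimage_stAffine`).
* (p3) "`|u^k(y'_k, 0, 0)| = 1`, `y'_k = M_k x_k'`. According to (p2), `|y'_k| ≤ A₂`", (p4)
  "`y'_k → y'_*`": `y_k = λ_k⁻¹ (x_k)'`, `|u^k(y_k, 0)| = λ_k M_k = 1/2` for the continuous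
  representative `λ_k v ∘ Φ_k` (continuous on `𝒞(R_k) × ]-R_k², 0]`, which `Φ_k` maps into the
  backward cylinder), `‖y_k‖ = 2M_k|x_k'| ≤ 2C₂` by Prop. 3.7 at `z_k`, and Bolzano–Weierstrass
  (`tendsto_subseq_of_bounded`) extracts `y_{φ(k)} → y_*`.
* (p5), axial symmetry, (p2) ⇒ (p10): `|u^k| ≤ 1` and `|y'||u^k| ≤ C₂` a.e. on `Q(R_k)`
  (transport of a.e. statements along `Φ_k`, `ae_restrict_preimage_stAffine`; the weight `|y'|`
  is invariant under the axis-centred scaling), and the slices of `u^k` are axisymmetric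
  (`isAxisymmetric_rescale`).
* "`‖F^k‖_{3/2,Q(4a)} ≤ c₁(a)`" (the pressure part): `∫_{Q(a)} |p^k|^{3/2} =
  λ_k⁻² ∫_{Q((t_k, x_{k3}e₃), aλ_k)} |p|^{3/2}` (`setLIntegral_pressure_axis_rescale`: Jacobian
  `λ_k⁵`, `(λ_k²)^{3/2} = λ_k³`), and `Q((t_k, x_{k3}e₃), aλ_k) ⊆ Q((0, x_{k3}e₃), r')`,
  `r' = λ_k √(a² + 4C²)`, because Type I at `z_k` gives `|t_k| ≤ (C/M_k)² = 4C²λ_k²`; Lemma 3.5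
  at the axis centre `(0, x_{k3}e₃)` (`|x_{k3}| ≤ 1/10 ≤ 1/4`, `r' < 1/4` for `k` large since
  `λ_k → 0`) bounds `D ≤ C₁`, whence `∫_{Q(a)} |p^k|^{3/2} ≤ λ_k⁻² r'² C₁ = (a² + 4C²) C₁` for all
  large `k` — the reason `BlowupAlternativeTypeI` keeps the full printed range `|b| ≤ 1/4` of
  Lemma 3.5 (module docstring of `SereginSverakBlowup`).
* The subsequence `φ` and these data are fed to `BlowupCompactness` with `A₂ = C₂`, `m = 1/2`.

## Contents

* `SereginSverak2009.setLIntegral_pressure_axis_rescale` — the change of variables for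
  `∫ |p^k|^{3/2}`;
* `SereginSverak2009.isDistributionalNSSolutionOn_axis_rescale` — the equations for
  `(u^k, p^k)` on `Q(R)` whenever `Φ(Q(R)) ⊆ Q`;
* `SereginSverak2009.blowupAlternativeTypeI_of_facts` — the reduction;
* `SereginSverak2009.isRegularAtOrigin_of_typeI_of_facts` — Thm. 3.1 from the catalogued inputs.

## Not here

`InteriorContinuity_holds`, `BlowupCompactness_holds` (hence no unconditional
`BlowupAlternativeTypeI_holds`); Lemma 3.6 and the Thm. 3.2 variant of the alternative.

## References

* G. Seregin, V. Šverák, Comm. PDE 34 (2009) 171–201 = arXiv:0804.1803: §3 p. 9 (Thm. 3.1 (r3),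
  Lemma 3.5 (as4)–(as5)), p. 10 (Prop. 3.7), §4 p. 11 ((p1)–(p12) and the estimates after (p12)).
  [`SereginSverak2009`]
* G. Koch, N. Nadirashvili, G. Seregin, V. Šverák, Acta Math. 203 (2009), Thm. 5.3.
  [`KochNadirashviliSereginSverak2009`]
-/

noncomputable section

open MeasureTheory Set Function Filter Topology TopologicalSpace Metric
open scoped NNReal ENNReal

namespace Literature.Analysis.FluidPDE

namespace SereginSverak2009

/-! ### Two more covariance lemmas for the axis-centred rescaling -/

/-- **Covariance of the pressure functional** under `Φ(s, y) = (t₀ + λ² s, x₀ + λ y)`, `λ > 0`: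
`∫_{Q(0, a)} |λ² p ∘ Φ|^{3/2} = λ⁻² ∫_{Q((t₀, x₀), aλ)} |p|^{3/2}` (the Jacobian of `Φ` is `λ⁵`
and `(λ²)^{3/2} = λ³`; this is the scale invariance of `D` of §3). [folklore] -/
theorem setLIntegral_pressure_axis_rescale (p : ℝ → EuclideanSpace ℝ (Fin 3) → ℝ) (t₀ : ℝ)
    (x₀ : EuclideanSpace ℝ (Fin 3)) {lam : ℝ} (hlam : 0 < lam) (a : ℝ) :
    ∫⁻ z in parCyl 0 a, ‖(lam ^ 2 • stPull (lam ^ 2) lam t₀ x₀ p) z.1 z.2‖ₑ ^ (3 / 2 : ℝ) =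
      ENNReal.ofReal (lam ^ 2)⁻¹ *
        ∫⁻ z in parCyl (t₀, x₀) (a * lam), ‖p z.1 z.2‖ₑ ^ (3 / 2 : ℝ) := by
  have hset : stAffine (lam ^ 2) lam t₀ x₀ ⁻¹' parCyl (t₀, x₀) (a * lam) = parCyl 0 a := by
    rw [stAffine_preimage_parCyl hlam, mul_div_cancel_right₀ a hlam.ne']
  rw [← hset, setLIntegral_enorm_rpow_stRescale (by positivity : 0 < lam ^ 2) hlam t₀ x₀ (lam ^ 2) p
    (parCyl (t₀, x₀) (a * lam)) (by norm_num : (0 : ℝ) ≤ 3 / 2), finrank_euclideanSpace_fin]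
  congr 1
  have h32 : (lam ^ 2) ^ ((3 : ℝ) / 2) = lam ^ 3 := by
    rw [← Real.rpow_natCast lam 2, ← Real.rpow_mul hlam.le,
      show ((2 : ℕ) : ℝ) * ((3 : ℝ) / 2) = ((3 : ℕ) : ℝ) by norm_num, Real.rpow_natCast]
  rw [Real.enorm_eq_ofReal (sq_nonneg lam), ENNReal.ofReal_rpow_of_nonneg (sq_nonneg lam)
    (by norm_num), h32, ← ENNReal.ofReal_mul (by positivity)]
  congr 1
  field_simp

/-- **The rescaled pair solves Navier–Stokes in `Q(R)`** (Seregin–Šverák 2009, §4: "These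
functions satisfy the Navier–Stokes equations in `Q(M_k)`"): if `(u, p)` solves the system
(`ν = 1`, no force) in the sense of distributions in `Q` and `Φ(s, y) = (t₀ + λ² s, x₀ + λ y)`
(`λ > 0`) maps `Q(0, R)` into `Q`, then `(λ u ∘ Φ, λ² p ∘ Φ)` solves it in `Q(0, R)` (accepted
`IsDistributionalNSSolutionOn.stRescale` and `.of_le`).
[cite: SereginSverak2009, §4 (arXiv p. 11)] -/
theorem isDistributionalNSSolutionOn_axis_rescale
    {u : ℝ → EuclideanSpace ℝ (Fin 3) → EuclideanSpace ℝ (Fin 3)}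
    {p : ℝ → EuclideanSpace ℝ (Fin 3) → ℝ}
    (h : IsDistributionalNSSolutionOn (parCylOpens 0 1) 1 0 u p)
    {t₀ : ℝ} {x₀ : EuclideanSpace ℝ (Fin 3)} {lam R : ℝ} (hlam : 0 < lam)
    (hsub : parCyl 0 R ⊆ stAffine (lam ^ 2) lam t₀ x₀ ⁻¹' parCyl 0 1) :
    IsDistributionalNSSolutionOn (parCylOpens 0 R) 1 0
      (lam • stPull (lam ^ 2) lam t₀ x₀ u) (lam ^ 2 • stPull (lam ^ 2) lam t₀ x₀ p) := by
  have key := h.stRescale hlam hlam (by ring : lam ^ 2 = lam * lam) t₀ x₀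
  have h1 : lam * 1 / lam = 1 := by field_simp
  have h2 : ((lam ^ 2 * lam) • stPull (lam ^ 2) lam t₀ x₀
      (0 : ℝ → EuclideanSpace ℝ (Fin 3) → EuclideanSpace ℝ (Fin 3))) = 0 := by
    funext s y
    simp [stPull_apply]
  rw [h1, h2] at key
  exact key.of_le fun w hw => hsub hw

/-! ### The blow-up alternative under Type I from the two analytic inputs -/

/-- **Seregin–Šverák 2009, §4 for Theorem 3.1: the blow-up alternative under the Type I bound,
reduced to its two analytic inputs** (arXiv:0804.1803, p. 11). From `InteriorContinuity` (the
continuous representative `v` of §4 ¶1) and `BlowupCompactness` ((p5)–(p12)ff: the limit of the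
rescaled sequence is a non-zero axisymmetric bounded ancient weak solution with `|y'||w| ≤ A₂`)
the fact `BlowupAlternativeTypeI` follows by the printed bookkeeping (module docstring): the
a.e. hypotheses become pointwise bounds for `v`; a singular origin yields centres `z_k` with
`|v| ≤ 2M_k` on a backward cylinder of size `d_k/2` and `M_k d_k ≥ k + K₀` (`exists_centre`, in
print running maxima); the axis-centred rescaling `u^k = λ_k u ∘ Φ_k`, `λ_k = 1/(2M_k)`, solves
Navier–Stokes in `Q(R_k)`, `R_k → ∞`, is axisymmetric, obeys `|u^k| ≤ 1`, `|y'||u^k| ≤ C₂` a.e.,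
`|u^k(y_k, 0)| = 1/2` with `‖y_k‖ ≤ 2C₂` ((p3)), and `∫_{Q(a)} |p^k|^{3/2} ≤ (a² + 4C²) C₁` for
large `k` by Lemma 3.5 at the axis centres `(0, x_{k3}e₃)` and Type I at `z_k`; a subsequence
with `y_k → y_*` ((p4)) is fed to `BlowupCompactness` with `m = 1/2`.
[cite: SereginSverak2009, §4 (proof of Thm. 3.1, (p1)–(p11), arXiv p. 11)] -/
theorem blowupAlternativeTypeI_of_facts (hIC : InteriorContinuity) (hBC : BlowupCompactness) :
    BlowupAlternativeTypeI := by
  intro u p hsol hI h35 h37 hsing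
  obtain ⟨G, -, C₁, hC₁⟩ := h35
  obtain ⟨C₂, hC₂⟩ := h37
  have hr2 : IsBoundedAwayFromZero u := isBoundedAwayFromZero_of_isTypeIOnCyl hI
  obtain ⟨C, hC⟩ := hI
  -- Step 1: the continuous representative (§4 ¶1) and pointwise bounds for it
  obtain ⟨v, hv, hvu⟩ := hIC u p hsol.distributional hsol.velocity_L3 hsol.pressure_L32 hr2
  have h18 : parCyl 0 (1 / 8) ⊆ parCyl 0 1 := parCyl_mono 0 (by norm_num) (by norm_num)
  have hTI : ∀ z ∈ parCyl 0 1, Real.sqrt (-z.1) * ‖v z‖ ≤ C :=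
    forall_mul_norm_le_of_ae (isOpen_parCyl 0 1)
      (Real.continuous_sqrt.comp (continuous_neg.comp continuous_fst)).continuousOn hv hvu hC
  have hAD : ∀ z ∈ parCyl 0 (1 / 8), cylRadius z.2 * ‖v z‖ ≤ C₂ :=
    forall_mul_norm_le_of_ae (isOpen_parCyl 0 (1 / 8))
      (continuous_cylRadius.comp continuous_snd).continuousOn (hv.mono h18)
      (ae_restrict_of_ae_restrict_of_subset h18 hvu) hC₂
  -- Step 2: the centres `z k` and sizes `d k` at levels `k + K₀`
  set K₀ : ℝ := 4 * max C₂ 0 + 1 with hK₀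
  have hmax0 : C₂ ≤ max C₂ 0 := le_max_left _ _
  have hmax1 : 0 ≤ max C₂ 0 := le_max_right _ _
  have hK₀pos : 0 < K₀ := by rw [hK₀]; linarith
  choose z d hz8 hz3 hd hd10 hN hbd hback using
    fun k : ℕ => exists_centre hv hvu hsing (N := (k : ℝ) + K₀) (by positivity)
  have hzQ : ∀ k, z k ∈ parCyl 0 1 := fun k => h18 (hz8 k)
  have hxM : ∀ k, cylRadius (z k).2 * ‖v (z k)‖ ≤ C₂ := fun k => hAD (z k) (hz8 k)
  have hM : ∀ k, 0 < ‖v (z k)‖ := fun k => by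
    rcases (norm_nonneg (v (z k))).lt_or_eq with h | h
    · exact h
    · have h1 := hN k
      rw [← h, zero_mul] at h1
      have h2 : (0 : ℝ) ≤ k := Nat.cast_nonneg k
      linarith
  -- the scales `λ_k = 1/(2 M_k)`
  obtain ⟨lam, hlamdef⟩ : ∃ lam : ℕ → ℝ, ∀ k, lam k = (2 * ‖v (z k)‖)⁻¹ := ⟨_, fun k => rfl⟩
  have hlam0 : ∀ k, 0 < lam k := fun k => by
    rw [hlamdef]
    have := hM k
    positivity
  have hl2 : ∀ k, 0 < lam k ^ 2 := fun k => pow_pos (hlam0 k) 2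
  have hlam2M : ∀ k, lam k * (2 * ‖v (z k)‖) = 1 := fun k => by
    rw [hlamdef]
    exact inv_mul_cancel₀ (by have := hM k; positivity)
  have hlamM : ∀ k, lam k * ‖v (z k)‖ = 1 / 2 := fun k => by
    have := hlam2M k
    linarith
  have hinvlam : ∀ k, (lam k)⁻¹ = 2 * ‖v (z k)‖ := fun k => by rw [hlamdef, inv_inv]
  have hinvM : ∀ k, (‖v (z k)‖)⁻¹ = 2 * lam k := fun k => by
    rw [hlamdef, mul_inv, ← mul_assoc, mul_inv_cancel₀ (two_ne_zero : (2 : ℝ) ≠ 0), one_mul]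
  -- the points `y_k = λ_k⁻¹ (x_k)'` and the radii `R_k`
  obtain ⟨y, hydef⟩ : ∃ y : ℕ → EuclideanSpace ℝ (Fin 3), ∀ k, y k = (lam k)⁻¹ • horiz (z k).2 :=
    ⟨_, fun k => rfl⟩
  have hyrad : ∀ k, cylRadius (y k) = 2 * (cylRadius (z k).2 * ‖v (z k)‖) := fun k => by
    rw [hydef, cylRadius_inv_smul_horiz (hlam0 k), hinvlam]
    ring
  obtain ⟨R, hRdef⟩ :
      ∃ R : ℕ → ℝ, ∀ k, R k = d k / 2 / lam k - cylRadius ((lam k)⁻¹ • horiz (z k).2) :=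
    ⟨_, fun k => rfl⟩
  have hRcond : ∀ k, R k + cylRadius ((lam k)⁻¹ • horiz (z k).2) ≤ d k / 2 / lam k :=
    fun k => by rw [hRdef, sub_add_cancel]
  have hRval : ∀ k, R k = ‖v (z k)‖ * d k - 2 * (cylRadius (z k).2 * ‖v (z k)‖) := fun k => by
    rw [hRdef, ← hydef, hyrad, hlamdef, div_inv_eq_mul]
    ring
  have hRge : ∀ k : ℕ, (k : ℝ) + K₀ - 2 * C₂ ≤ R k := fun k => by
    rw [hRval]
    linarith [hN k, hxM k]
  have hR0 : ∀ k, 0 < R k := fun k => by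
    have h1 := hRge k
    have h2 : (0 : ℝ) ≤ k := Nat.cast_nonneg k
    rw [hK₀] at h1
    linarith
  have hRy : ∀ k, cylRadius (y k) < R k := fun k => by
    rw [hyrad]
    have h1 := hRge k
    have h2 : (0 : ℝ) ≤ k := Nat.cast_nonneg k
    rw [hK₀] at h1
    linarith [hxM k]
  have hR_tend : Tendsto R atTop atTop := by
    refine tendsto_atTop_mono (fun k => ?_) tendsto_natCast_atTop_atTop
    have h1 := hRge k
    rw [hK₀] at h1
    linarith
  have hlam_tend : Tendsto lam atTop (𝓝 0) := by
    have h2M : Tendsto (fun k => 2 * ‖v (z k)‖) atTop atTop := by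
      refine tendsto_atTop_mono (fun k => ?_) tendsto_natCast_atTop_atTop
      have h1 := hN k
      have h2 := hd10 k
      have h3 := hM k
      have h4 := hd k
      nlinarith
    have : lam = fun k => (2 * ‖v (z k)‖)⁻¹ := funext hlamdef
    rw [this]
    exact tendsto_inv_atTop_zero.comp h2M
  -- the inclusions `Q(R_k) ⊆ Φ_k⁻¹(backCyl) ⊆ Φ_k⁻¹(Q(1/8)) ⊆ Φ_k⁻¹(Q)`
  have hpreB : ∀ k, parCyl 0 (R k) ⊆
      stAffine (lam k ^ 2) (lam k) (z k).1 ((z k).2 2 • eZ) ⁻¹' backCyl (z k) (d k / 2) :=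
    fun k => parCyl_subset_preimage_stAffine (hlam0 k) (z k) (hRcond k) Subset.rfl
  have hpre8 : ∀ k, parCyl 0 (R k) ⊆
      stAffine (lam k ^ 2) (lam k) (z k).1 ((z k).2 2 • eZ) ⁻¹' parCyl 0 (1 / 8) :=
    fun k => parCyl_subset_preimage_stAffine (hlam0 k) (z k) (hRcond k) (hback k)
  have hpre1 : ∀ k, parCyl 0 (R k) ⊆
      stAffine (lam k ^ 2) (lam k) (z k).1 ((z k).2 2 • eZ) ⁻¹' parCyl 0 1 :=
    fun k => parCyl_subset_preimage_stAffine (hlam0 k) (z k) (hRcond k) ((hback k).trans h18)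
  -- Step 3: the rescaled fields `u^k = λ_k u ∘ Φ_k`, `p^k = λ_k² p ∘ Φ_k`
  obtain ⟨U, hUdef⟩ : ∃ U : ℕ → ℝ → EuclideanSpace ℝ (Fin 3) → EuclideanSpace ℝ (Fin 3),
      ∀ k, U k = lam k • stPull (lam k ^ 2) (lam k) (z k).1 ((z k).2 2 • eZ) u :=
    ⟨_, fun k => rfl⟩
  obtain ⟨P, hPdef⟩ : ∃ P : ℕ → ℝ → EuclideanSpace ℝ (Fin 3) → ℝ,
      ∀ k, P k = lam k ^ 2 • stPull (lam k ^ 2) (lam k) (z k).1 ((z k).2 2 • eZ) p :=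
    ⟨_, fun k => rfl⟩
  -- (i) the equations in `Q(R_k)`
  have hsolk : ∀ k, IsDistributionalNSSolutionOn (parCylOpens 0 (R k)) 1 0 (U k) (P k) := by
    intro k
    rw [hUdef, hPdef]
    exact isDistributionalNSSolutionOn_axis_rescale hsol.distributional (hlam0 k) (hpre1 k)
  -- (ii) `|u^k| ≤ 1` a.e. on `Q(R_k)` ((p5) with `λ_k = 1/(2M_k)`)
  have hbdk : ∀ k, ∀ᵐ w ∂(volume.restrict (parCyl 0 (R k))), ‖U k w.1 w.2‖ ≤ 1 := by
    intro k
    have h1 := ae_restrict_of_ae_restrict_of_subset (hpre1 k)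
      (ae_eq_restrict_comp_stAffine (hl2 k) (hlam0 k) (z k).1 ((z k).2 2 • eZ) hvu)
    filter_upwards [ae_restrict_mem (isOpen_parCyl 0 (R k)).measurableSet, h1] with w hw hwv
    simp only [comp_apply] at hwv
    have hb := hbd k _ (hpreB k hw)
    rw [hwv] at hb
    have hb' : ‖u ((z k).1 + lam k ^ 2 * w.1) ((z k).2 2 • eZ + lam k • w.2)‖ ≤
        2 * ‖v (z k)‖ := hb
    rw [hUdef, smul_stPull_apply, norm_smul, Real.norm_eq_abs, abs_of_pos (hlam0 k)]
    calc lam k * ‖u ((z k).1 + lam k ^ 2 * w.1) ((z k).2 2 • eZ + lam k • w.2)‖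
        ≤ lam k * (2 * ‖v (z k)‖) := mul_le_mul_of_nonneg_left hb' (hlam0 k).le
      _ = 1 := hlam2M k
  -- (iii) axial symmetry of the slices of `u^k`
  have haxik : ∀ k, ∀ s ∈ Ioo (-R k ^ 2) 0, IsAxisymmetric (U k s) := by
    intro k s hs
    have hmem := hpre1 k (mem_parCyl_zero_of_time (hR0 k) hs)
    rw [mem_preimage, stAffine_apply] at hmem
    have ht : (z k).1 + lam k ^ 2 * s ∈ Ioo (-1 : ℝ) 0 := by
      have := (mem_parCyl_zero.1 hmem).1
      simpa using this
    rw [hUdef]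
    exact isAxisymmetric_rescale (hsol.axisymmetric _ ht) (lam k) ((z k).2 2) (lam k)
  -- (iv) `|y'| |u^k| ≤ C₂` a.e. on `Q(R_k)` ((p2) ⇒ (p10))
  have hdeck : ∀ k, ∀ᵐ w ∂(volume.restrict (parCyl 0 (R k))),
      cylRadius w.2 * ‖U k w.1 w.2‖ ≤ C₂ := by
    intro k
    have h1 := ae_restrict_of_ae_restrict_of_subset (hpre8 k)
      (ae_restrict_preimage_stAffine (hl2 k) (hlam0 k) (z k).1 ((z k).2 2 • eZ)
        (P := fun w => cylRadius w.2 * ‖u w.1 w.2‖ ≤ C₂) hC₂)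
    filter_upwards [h1] with w hw
    rw [stAffine_snd, stAffine_fst, cylRadius_smul_eZ_add, cylRadius_smul, abs_of_pos (hlam0 k)]
      at hw
    rw [hUdef, smul_stPull_apply, norm_smul, Real.norm_eq_abs, abs_of_pos (hlam0 k)]
    calc cylRadius w.2 * (lam k * ‖u ((z k).1 + lam k ^ 2 * w.1) ((z k).2 2 • eZ + lam k • w.2)‖)
        = lam k * cylRadius w.2 *
            ‖u ((z k).1 + lam k ^ 2 * w.1) ((z k).2 2 • eZ + lam k • w.2)‖ := by ring
      _ ≤ C₂ := hw
  -- (v) continuous representatives, `y_k ∈ 𝒞(R_k)` and `|u^k(y_k, 0)| = 1/2` ((p3))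
  have hVk : ∀ k, ∃ V : ℝ × EuclideanSpace ℝ (Fin 3) → EuclideanSpace ℝ (Fin 3),
      ContinuousOn V (parCylTop (R k)) ∧
      V =ᵐ[volume.restrict (parCyl 0 (R k))] uncurry (U k) ∧
      y k ∈ spaceCyl 0 (R k) ∧ (1 / 2 : ℝ) ≤ ‖V (0, y k)‖ := by
    intro k
    refine ⟨fun w => lam k • v (stAffine (lam k ^ 2) (lam k) (z k).1 ((z k).2 2 • eZ) w),
      ?_, ?_, ?_, ?_⟩
    · -- continuity on `𝒞(R_k) × ]-R_k², 0]`, which `Φ_k` maps into the backward cylinder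
      have hmaps : MapsTo (stAffine (lam k ^ 2) (lam k) (z k).1 ((z k).2 2 • eZ))
          (parCylTop (R k)) (parCyl 0 1) := by
        intro w hw
        rw [mem_parCylTop, mem_spaceCyl] at hw
        obtain ⟨⟨h1, h2⟩, h3, h4⟩ := hw
        rw [sub_zero] at h3
        simp only [PiLp.zero_apply, sub_zero] at h4
        exact h18 (hback k (stAffine_mem_backCyl_of_mem (hlam0 k) (z k) (hRcond k) h1 h2 h3 h4))
      exact (hv.comp (continuous_stAffine _ _ _ _).continuousOn hmaps).const_smul (lam k)
    · -- a.e. identification with `u^k`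
      have h1 := ae_restrict_of_ae_restrict_of_subset (hpre1 k)
        (ae_eq_restrict_comp_stAffine (hl2 k) (hlam0 k) (z k).1 ((z k).2 2 • eZ) hvu)
      filter_upwards [h1] with w hw
      simp only [comp_apply] at hw
      rw [hUdef, hw]
      rfl
    · -- `y_k ∈ 𝒞(R_k)`: `|y_k'| = 2M_k|x_k'| ≤ 2C₂ < R_k` and `(y_k)₃ = 0`
      have hy2 : y k 2 = 0 := by
        rw [hydef]
        simp
      rw [mem_spaceCyl, sub_zero]
      refine ⟨hRy k, ?_⟩
      rw [hy2, PiLp.zero_apply, sub_zero, abs_zero]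
      exact hR0 k
    · -- `|λ_k v(z_k)| = 1/2`
      have hpt : stAffine (lam k ^ 2) (lam k) (z k).1 ((z k).2 2 • eZ) (0, y k) = z k := by
        rw [hydef]
        exact stAffine_zero_inv_smul_horiz (hlam0 k).ne' (z k)
      show 1 / 2 ≤ ‖lam k • v (stAffine (lam k ^ 2) (lam k) (z k).1 ((z k).2 2 • eZ) (0, y k))‖
      rw [hpt, norm_smul, Real.norm_eq_abs, abs_of_pos (hlam0 k), hlamM k]
  -- (vi) the pressure bound on `Q(a)` from Lemma 3.5 at the axis centres `(0, x_{k3} e₃)`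
  have hpress : ∀ a : ℝ, 0 < a → ∃ c : ℝ≥0, ∀ᶠ k in atTop,
      ∫⁻ w in parCyl 0 a, ‖P k w.1 w.2‖ₑ ^ (3 / 2 : ℝ) ≤ c := by
    intro a ha
    set S : ℝ := Real.sqrt (a ^ 2 + 4 * C ^ 2) with hS
    have hS0 : 0 < S := Real.sqrt_pos.2 (by positivity)
    have hS2 : S ^ 2 = a ^ 2 + 4 * C ^ 2 := Real.sq_sqrt (by positivity)
    have hSa : a ≤ S := by
      rw [hS, Real.le_sqrt ha.le (by positivity)]
      nlinarith
    set c : ℝ≥0 := (a ^ 2 + 4 * C ^ 2).toNNReal * C₁ with hc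
    refine ⟨c, ?_⟩
    filter_upwards [hlam_tend.eventually (gt_mem_nhds (show (0 : ℝ) < 1 / (4 * S) by positivity))]
      with k hk
    have hr'0 : 0 < lam k * S := mul_pos (hlam0 k) hS0
    have hr'4 : lam k * S < 1 / 4 := by
      rw [lt_div_iff₀ (by positivity)] at hk
      linarith
    have hb : |(z k).2 2| ≤ 1 / 4 := (hz3 k).trans (by norm_num)
    -- Lemma 3.5 at centre `(0, x_{k3} e₃)` and radius `λ_k S`
    have hD : pressureD ((0 : ℝ), (z k).2 2 • eZ) (lam k * S) p ≤ C₁ :=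
      (pressureD_le_sum _ _ u G p).trans (hC₁ _ hb (lam k * S) ⟨hr'0, hr'4⟩)
    have hint : ∫⁻ w in parCyl ((0 : ℝ), (z k).2 2 • eZ) (lam k * S), ‖p w.1 w.2‖ₑ ^ (3 / 2 : ℝ) ≤
        ENNReal.ofReal (lam k * S) ^ 2 * C₁ := by
      rw [setLIntegral_eq_mul_pressureD _ hr'0]
      gcongr
    -- Type I at `z_k`: `|t_k| ≤ (C/M_k)² = 4C²λ_k²`
    have hzk := mem_parCyl_zero.1 (hzQ k)
    have ht4 : -(z k).1 ≤ (2 * C * lam k) ^ 2 := by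
      have h1 := neg_le_sq_of_sqrt_mul_le hzk.1.2.le (hM k) (hTI (z k) (hzQ k))
      rw [div_eq_mul_inv, hinvM k] at h1
      calc -(z k).1 ≤ (C * (2 * lam k)) ^ 2 := h1
        _ = (2 * C * lam k) ^ 2 := by ring
    have hincl : parCyl ((z k).1, (z k).2 2 • eZ) (a * lam k) ⊆
        parCyl ((0 : ℝ), (z k).2 2 • eZ) (lam k * S) := by
      have e3 : (lam k * S) ^ 2 = lam k ^ 2 * (a ^ 2 + 4 * C ^ 2) := by rw [mul_pow, hS2]
      refine parCyl_subset_parCyl_zero_time hzk.1.2.le (by nlinarith [hlam0 k]) ?_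
      rw [e3]
      nlinarith [ht4]
    rw [hPdef, setLIntegral_pressure_axis_rescale p _ _ (hlam0 k) a]
    calc ENNReal.ofReal (lam k ^ 2)⁻¹ *
          ∫⁻ w in parCyl ((z k).1, (z k).2 2 • eZ) (a * lam k), ‖p w.1 w.2‖ₑ ^ (3 / 2 : ℝ)
        ≤ ENNReal.ofReal (lam k ^ 2)⁻¹ * (ENNReal.ofReal (lam k * S) ^ 2 * C₁) := by
          gcongr
          exact (lintegral_mono_set hincl).trans hint
      _ = (c : ℝ≥0∞) := by
          rw [← mul_assoc, ← ENNReal.ofReal_pow hr'0.le, ← ENNReal.ofReal_mul (by positivity),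
            hc, ENNReal.coe_mul]
          have e : (lam k ^ 2)⁻¹ * (lam k * S) ^ 2 = a ^ 2 + 4 * C ^ 2 := by
            rw [mul_pow, hS2, ← mul_assoc, inv_mul_cancel₀ (pow_ne_zero 2 (hlam0 k).ne'), one_mul]
          rw [e]
          rfl
  -- Step 4: a subsequence with `y_k → y_*` ((p4)) and the compactness fact
  have hybd : ∀ k, y k ∈ closedBall (0 : EuclideanSpace ℝ (Fin 3)) (2 * max C₂ 0) := by
    intro k
    rw [mem_closedBall_zero_iff, hydef, norm_inv_smul_horiz (hlam0 k), hinvlam]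
    nlinarith [hxM k, hM k, cylRadius_nonneg (z k).2]
  obtain ⟨yStar, -, φ, hφ, hφy⟩ := tendsto_subseq_of_bounded isBounded_closedBall hybd
  have hpressφ : ∀ a : ℝ, 0 < a → ∃ c : ℝ≥0, ∀ᶠ k in atTop,
      ∫⁻ w in parCyl 0 a, ‖P (φ k) w.1 w.2‖ₑ ^ (3 / 2 : ℝ) ≤ c := by
    intro a ha
    obtain ⟨c, hc⟩ := hpress a ha
    exact ⟨c, hφ.tendsto_atTop.eventually hc⟩
  obtain ⟨w, hw, hwaxi, hwdec, hwne⟩ := hBC (fun k => U (φ k)) (fun k => P (φ k))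
    (fun k => R (φ k)) (fun k => y (φ k)) yStar C₂ (1 / 2) (hR_tend.comp hφ.tendsto_atTop) hφy
    (by norm_num) (fun k => hsolk (φ k)) (fun k => hbdk (φ k)) (fun k => haxik (φ k))
    (fun k => hdeck (φ k)) hpressφ (fun k => hVk (φ k))
  exact ⟨w, hw, hwaxi, ⟨C₂, hwdec⟩, hwne⟩

/-- **Seregin–Šverák 2009, Theorem 3.1, conditional on the catalogued analytic inputs only**:
from Lemma 3.5 (`ScaledEnergyBound`), Prop. 3.7 (`AxisDecayBound`), interior continuity
(`InteriorContinuity`), the compactness of the blow-up sequence (`BlowupCompactness`) and the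
Liouville theorem of KNSS 2009, Thm. 5.3 (`KNSS2009_liouville_bound_C_over_r`), every axially
symmetric distributional solution in `Q` with `u ∈ L³(Q)`, `p ∈ L^{3/2}(Q)` and the Type I bound
is regular at the origin. [cite: SereginSverak2009, Thm. 3.1 and §4] -/
theorem isRegularAtOrigin_of_typeI_of_facts (h35 : ScaledEnergyBound) (h37 : AxisDecayBound)
    (hIC : InteriorContinuity) (hBC : BlowupCompactness)
    (h53 : KNSS2009_liouville_bound_C_over_r)
    {u : ℝ → EuclideanSpace ℝ (Fin 3) → EuclideanSpace ℝ (Fin 3)}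
    {p : ℝ → EuclideanSpace ℝ (Fin 3) → ℝ}
    (hsol : IsAxisymmetricLocalSolution u p) (hI : IsTypeIOnCyl u) : IsRegularAtOrigin u :=
  isRegularAtOrigin_of_typeI' h35 h37 (blowupAlternativeTypeI_of_facts hIC hBC) h53 hsol hI

end SereginSverak2009

end Literature.Analysis.FluidPDE
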